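import Summits.KontsevichZagierPeriods.KontsevichZagierPeriods.Theorems.ValuedFieldSpecialisationParametricLiftingStrata

/-!
# Route ValuedFieldSpecialisation — crux `ParametricLifting` (stmt-KontsevichZagierPeriods-3498):
# graded special-fibre rigidity is UNCONDITIONAL in fibre dimension `0` (lead c9, sub-goal W2)

Helper (`--supports stmt-KontsevichZagierPeriods-3498`) for line `registered`. Write level `E` :=
`AddSubgroup.closure {[r] | dim r < E}` and KL(`E`) := "every `x` on level `E` with `KZ.eval x = 0` is a
relation". The special-fibre rigidity SF of the route (`…ParametricLiftingStrength.lean`: the special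
fibres `r₀ᵢ` of a DOMINATED net `Σ mᵢ [Rᵢ] ∈ KZ.fibredRelations` satisfy `Σ mᵢ [r₀ᵢ] ∈ KZ.relations`) is
graded by the fibre dimension in the c9 programme; this file settles its lowest layer outright:

* `stub_specialFibreGraded_one` — **SF holds unconditionally when every special fibre has dimension
  `< 1`** (constants). Three steps, all tree theorems: (1) the VALUE shadow `eval_specialFibre_eq_zero`
  (slices of a fibred relation vanish a.e., dominated slices converge — Lebesgue — so
  `KZ.eval (Σ mᵢ [r₀ᵢ]) = 0`); (2) `d i < 1` forces `d i = 0`, so `Σ mᵢ [r₀ᵢ]` lies in the subgroup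
  generated by the `0`-dimensional classes; (3) on that subgroup the kernel of `KZ.eval` IS
  `KZ.relations` (`ReducedPeriodRingNegative.dimZero_kernel`, route ReducedPeriodRing: every constant
  combination is one constant `[pt, a]` with `a = eval`, and `[pt, 0]` is a relation).

So below fibre dimension `1` the crux chain spends no special-fibre rigidity at all; the first layer with
content is fibre dimension `1` (one-dimensional periods, sibling sub-goals W3/W4).

Sources: M. Kontsevich, D. Zagier, *Periods* (2001), §1.1 (`ℝ⁰` is a point of volume `1`), §1.2,
Conjecture 1 and rule (1); Lebesgue's dominated convergence (inside `eval_specialFibre_eq_zero`). The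
fibred / dominated vocabulary is this route's (`KZFibredRelations.lean`, `KZDominatedFamily.lean`).
No definition is introduced.
-/

noncomputable section

namespace Summit.KontsevichZagierPeriods.ValuedFieldSpecialisation

open MeasureTheory Set Filter
open scoped Topology
open Literature.NumberTheory.Transcendental

/-- **Graded special-fibre rigidity in fibre dimension `0`, unconditionally** (lead c9 sub-goal W2): if
`Σ mᵢ [Rᵢ] ∈ KZ.fibredRelations`, every `Rᵢ` is dominated near `s = 0⁺` with special fibre `r₀ᵢ`, and every
fibre dimension is `d i < 1`, then `Σ mᵢ [r₀ᵢ] ∈ KZ.relations`. Proof: its value is `0`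
(`eval_specialFibre_eq_zero`), it lies in the subgroup generated by the `0`-dimensional classes
(`d i = 0`), and there the kernel conjecture is a theorem (`ReducedPeriodRingNegative.dimZero_kernel`).
[cite: KontsevichZagier2001, §1.2 Conjecture 1] -/
theorem stub_specialFibreGraded_one : ∀ (k : ℕ) (d : Fin k → ℕ) (m : Fin k → ℤ) (R : (i : Fin k) → KZ.IntegralRep (d i + 1)) (r₀ g : (i : Fin k) → KZ.IntegralRep (d i)), (∀ i, d i < 1) → (∀ i, KZ.IsDominatedFamily (R i) (r₀ i) (g i)) → (∑ i, m i • KZ.of (R i)) ∈ KZ.fibredRelations → (∑ i, m i • KZ.of (r₀ i)) ∈ KZ.relations := by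
  intro k d m R r₀ g hd hR hG
  -- (1) the value shadow: the special-fibre class of a dominated fibred relation evaluates to `0`
  have h0 : KZ.eval (∑ i, m i • KZ.of (r₀ i)) = 0 := eval_specialFibre_eq_zero m hR hG
  -- (2) a representation of dimension `< 1` is a constant (stated for a variable dimension `n`, since
  -- `d i = 0` holds only propositionally)
  have key : ∀ (n : ℕ) (r : KZ.IntegralRep n), n < 1 →
      KZ.of r ∈ AddSubgroup.closure (Set.range fun r : KZ.IntegralRep 0 => KZ.of r) := by
    intro n r hn
    obtain rfl : n = 0 := by omega
    exact AddSubgroup.subset_closure ⟨r, rfl⟩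
  have hc : (∑ i, m i • KZ.of (r₀ i)) ∈
      AddSubgroup.closure (Set.range fun r : KZ.IntegralRep 0 => KZ.of r) :=
    sum_mem fun i _ => AddSubgroup.zsmul_mem _ (key (d i) (r₀ i) (hd i)) (m i)
  -- (3) the kernel conjecture holds on the constants
  exact Summit.KontsevichZagierPeriods.KontsevichZagierPeriods.ReducedPeriodRingNegative.dimZero_kernel
    hc h0

end Summit.KontsevichZagierPeriods.ValuedFieldSpecialisation
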